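import Literature.Analysis.FluidPDE.HouLiVariablesMemLp
import Literature.Analysis.FluidPDE.AxisymPhiFourEnergy
import Literature.Analysis.FluidPDE.AxisymQuotientBounds
import Literature.Analysis.FluidPDE.AxisymOuterBounds
import Literature.Analysis.FluidPDE.KNSSThm52Integrand
import Literature.Analysis.FluidPDE.TaoClassGlue
import HarnessLib

/-!
# The `ω^θ` energy: `d/dt ‖ω^θ‖² ≤ 2‖vʳ/r‖_∞ ‖ω^θ‖² + ‖V²‖²` at a fixed time
# (weighted `Ω`-estimate behind Lei–Zhang 2017, Thm. 1.4)

Analysis/FluidPDE proof file (theorems only; no definitions, no named facts) on the discharge path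
of the named fact `Literature.Analysis.FluidPDE.LeiZhang2017_smallSwirl_regularity`
(Lei–Zhang 2017, Thm. 1.4).

After the a-priori bound `‖V²‖² + ‖Ω‖² ≤ ‖V₀²‖² + ‖Ω₀‖²` (Lei–Zhang, arXiv:1505.02628, §4, p. 10;
`AxisymSmallSwirlBootstrap`), regularity follows from standard estimates; the first of them is the
`L²` bound of `ω^θ = r Ω` obtained from the `Ω`-equation
`∂ₜΩ + u·∇Ω = ν(Δ + (2/r)∂_r)Ω − 2ΦJ` (`J = −∂_zΦ`) multiplied by `r²Ω = (x₀² + x₁²)Ω`: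
`½ d/dt ∫ r²Ω² = ∫ r² (vʳ/r) Ω² − ν ∫ r²|∇Ω|² − ∫ r² ∂_zΩ Φ²`
(transport `∫ r²Ω u·∇Ω = −∫ (x·u_h) Ω²`, `r²(Δ + (2/r)∂_r)Ω = ∇·(r²∇Ω)`, and `2∫r²ΩΦ∂_zΦ = −∫r²∂_zΩΦ²`).

Main result (Tao's class, `ν = 1`, fixed `τ ∈ [0, T]`):

* `IsTaoSolutionOn.omegaTheta_slice_le` —
  `2 ∫ r² Ω Ω' ≤ 2 W_∞ ∫ r² Ω² + ∫ r² Φ⁴` for any bound `|vʳ/r| ≤ W_∞` at time `τ`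
  (`Ω' = angVortQuot (∂ₜu τ)`).

The weights are handled by the pointwise bounds `r|Ω| ≤ |ω|`, `r|Φ| ≤ |u|`,
`r|∂Ω| ≤ |∂Ω| + 3|ω| + |∇ω|` and `|Ω| r²|∂∂Ω| ≤ |ω||∇∂ω| + 2|Ω||∇ω| + 2Ω² + 4|ω||∂Ω|`, all from
`r²Ω = x₀ω₁ − x₁ω₀` and its derivatives, so that every weighted integrand is a product of two `L²`
functions of the Sobolev scale of `u`.

## Mathlib / tree search

Tree: `IsClassicalNSSolutionOn.angVortQuot_eq` (`AxisymQuotientEquationsOmega`),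
`IsAxisymmetric.radVelQuot_curl_eq_neg_fderiv_angVelQuot` (`AxisymQuotientBounds`),
`IsAxisymmetric.cylRadius_sq_mul_angVortQuot / angVelQuot / radVelQuot` (`AxisymHouLiVariables`),
`fderiv_apply_horizontal_eq` (`AxisymRadialQuotient`), `fderiv_swirl_apply`
(`SwirlTransportProofs`), `abs_swirl_le_cylRadius_mul_norm'` (`AxisymOuterBounds`),
`norm_iteratedFDeriv_curl_le` (`KNSSThm52Integrand`), `memLp_*_of_sobolev` (`HouLiVariablesMemLp`).
Mathlib: `integral_mul_fderiv_eq_neg_fderiv_mul_of_integrable`.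

## References

* Z. Lei, Q. S. Zhang, Pacific J. Math. 289 (2017) 169–187, arXiv:1505.02628, §4 (p. 10).
  [`LeiZhang2017`]
* T. Y. Hou, Z. Lei, C. Li, Comm. PDE 33 (2008), 1622–1637 (the variables `u₁, ω₁, ψ₁`). [folklore]
-/

noncomputable section

open MeasureTheory Set Function Filter Topology InnerProductSpace WithLp
open scoped RealInnerProductSpace Laplacian ContDiff ENNReal NNReal

namespace Literature.Analysis.FluidPDE

/-! ### Pointwise weighted bounds -/

section Pointwise

variable {u : EuclideanSpace ℝ (Fin 3) → EuclideanSpace ℝ (Fin 3)}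

/-- `‖J h‖ ≤ ‖h‖`. [folklore] -/
private theorem norm_rotGen_le_norm_aux (h : EuclideanSpace ℝ (Fin 3)) : ‖rotGen h‖ ≤ ‖h‖ := by
  refine le_of_sq_le_sq ?_ (norm_nonneg _)
  rw [norm_rotGen_sq, EuclideanSpace.norm_sq_eq, Fin.sum_univ_three]
  simp only [Real.norm_eq_abs, sq_abs]
  nlinarith [sq_nonneg (h 2)]

/-- `‖J x‖ = r`. [folklore] -/
theorem norm_rotGen_eq_cylRadius' (x : EuclideanSpace ℝ (Fin 3)) : ‖rotGen x‖ = cylRadius x := by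
  rw [norm_rotGen]; rfl

/-- `|swirl v x| ≤ r ‖v x‖`. [folklore] -/
theorem abs_swirl_le_cylRadius_mul (v : EuclideanSpace ℝ (Fin 3) → EuclideanSpace ℝ (Fin 3))
    (x : EuclideanSpace ℝ (Fin 3)) : |swirl v x| ≤ cylRadius x * ‖v x‖ :=
  abs_swirl_le_cylRadius_mul_norm' x (v x)

/-- `y ↦ ∂ᵥ f(y)` is `Cⁿ` when `f` is `Cⁿ⁺¹` (finite order). [folklore] -/
theorem contDiff_fderiv_apply_vec3_of_contDiff' {F' : Type*} [NormedAddCommGroup F'] [NormedSpace ℝ F']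
    {f : EuclideanSpace ℝ (Fin 3) → F'} {n : ℕ} (hf : ContDiff ℝ (n + 1) f) (v : EuclideanSpace ℝ (Fin 3)) :
    ContDiff ℝ n fun y => fderiv ℝ f y v :=
  (hf.fderiv_right (m := n) (by norm_cast)).clm_apply contDiff_const

/-- **`r |Ω| ≤ |ω|`** (`r²Ω = x₀ω₁ − x₁ω₀`, `Ω = ω^θ/r`). [folklore] -/
theorem IsAxisymmetric.cylRadius_mul_abs_angVortQuot_le (hax : IsAxisymmetric u) (hu : ContDiff ℝ 3 u)
    (x : EuclideanSpace ℝ (Fin 3)) : cylRadius x * |angVortQuot u x| ≤ ‖FluidPDE.curl u x‖ := by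
  rcases eq_or_lt_of_le (cylRadius_nonneg x) with hr | hr
  · rw [← hr, zero_mul]; exact norm_nonneg _
  have h := hax.cylRadius_sq_mul_angVortQuot hu x
  have h2 : cylRadius x ^ 2 * |angVortQuot u x| ≤ cylRadius x * ‖FluidPDE.curl u x‖ := by
    rw [← abs_of_nonneg (sq_nonneg (cylRadius x)), ← abs_mul, h]
    exact abs_swirl_le_cylRadius_mul _ x
  rw [sq, mul_assoc] at h2
  exact le_of_mul_le_mul_left h2 hr

/-- **`r |Φ| ≤ |u|`** (`r²Φ = Γ`, `Φ = u^θ/r`). [folklore] -/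
theorem IsAxisymmetric.cylRadius_mul_abs_angVelQuot_le (hax : IsAxisymmetric u) (hu : ContDiff ℝ 2 u)
    (x : EuclideanSpace ℝ (Fin 3)) : cylRadius x * |angVelQuot u x| ≤ ‖u x‖ := by
  rcases eq_or_lt_of_le (cylRadius_nonneg x) with hr | hr
  · rw [← hr, zero_mul]; exact norm_nonneg _
  have h := hax.cylRadius_sq_mul_angVelQuot hu x
  have h2 : cylRadius x ^ 2 * |angVelQuot u x| ≤ cylRadius x * ‖u x‖ := by
    rw [← abs_of_nonneg (sq_nonneg (cylRadius x)), ← abs_mul, h]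
    exact abs_swirl_le_cylRadius_mul _ x
  rw [sq, mul_assoc] at h2
  exact le_of_mul_le_mul_left h2 hr

/-- `|xᵢ| ≤ r` for the horizontal coordinates. [folklore] -/
theorem abs_coord_le_cylRadius (x : EuclideanSpace ℝ (Fin 3)) {i : Fin 3} (hi : i = 0 ∨ i = 1) :
    |x i| ≤ cylRadius x := by
  rw [cylRadius]
  rcases hi with rfl | rfl
  · calc |x 0| = Real.sqrt (x 0 ^ 2) := (Real.sqrt_sq_eq_abs _).symm
      _ ≤ _ := Real.sqrt_le_sqrt (by nlinarith [sq_nonneg (x 1)])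
  · calc |x 1| = Real.sqrt (x 1 ^ 2) := (Real.sqrt_sq_eq_abs _).symm
      _ ≤ _ := Real.sqrt_le_sqrt (by nlinarith [sq_nonneg (x 0)])

/-- The derivative of the swirl of a `C¹` field is bounded by `r‖∇ω h‖ + ‖h‖ ‖ω‖`. [folklore] -/
theorem abs_fderiv_swirl_le {w : EuclideanSpace ℝ (Fin 3) → EuclideanSpace ℝ (Fin 3)}
    (hw : Differentiable ℝ w) (x h : EuclideanSpace ℝ (Fin 3)) :
    |fderiv ℝ (swirl w) x h| ≤ cylRadius x * ‖fderiv ℝ w x h‖ + ‖h‖ * ‖w x‖ := by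
  rw [fderiv_swirl_apply (hw x) h]
  refine (abs_add_le _ _).trans (add_le_add ?_ ?_)
  · exact (abs_real_inner_le_norm _ _).trans (by rw [norm_rotGen_eq_cylRadius'])
  · exact (abs_real_inner_le_norm _ _).trans
      (mul_le_mul_of_nonneg_right (norm_rotGen_le_norm_aux h) (norm_nonneg _))

/-- **`r |∂_hΩ| ≤ |∂_hΩ| + 3|ω| + |∇ω|`** for `‖h‖ ≤ 1`: differentiate `ρΩ = swirl ω` (`ρ = r²`,
`ω = curl u`): `ρ ∂_hΩ = ∂_h(swirl ω) − ∂_hρ · Ω`, `|∂_h swirl ω| ≤ r‖∇ω‖ + |ω|`,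
`|∂_hρ · Ω| ≤ 2r|Ω| ≤ 2|ω|`; then split `r ≤ 1` / `r ≥ 1`. [folklore] -/
theorem IsAxisymmetric.cylRadius_mul_abs_fderiv_angVortQuot_le (hax : IsAxisymmetric u)
    (hu : ContDiff ℝ 4 u) {h : EuclideanSpace ℝ (Fin 3)} (hh : ‖h‖ ≤ 1) (x : EuclideanSpace ℝ (Fin 3)) :
    cylRadius x * |fderiv ℝ (angVortQuot u) x h| ≤
      |fderiv ℝ (angVortQuot u) x h| + 3 * ‖FluidPDE.curl u x‖ + ‖fderiv ℝ (FluidPDE.curl u) x‖ := by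
  set Ω := angVortQuot u with hΩ_def
  set w := FluidPDE.curl u with hw_def
  have hu3 : ContDiff ℝ 3 u := hu.of_le (by norm_cast)
  have hwc : ContDiff ℝ 1 w := contDiff_curl (n := 1) (by exact_mod_cast hu.of_le (by norm_cast))
  have hwd : Differentiable ℝ w := hwc.differentiable one_ne_zero
  have hΩc : ContDiff ℝ 1 Ω := contDiff_angVortQuot (n := 1) (by exact_mod_cast hu)
  have hΩd : Differentiable ℝ Ω := hΩc.differentiable one_ne_zero
  -- the identity `ρ Ω = swirl w` and its derivative
  have hid : (fun y : EuclideanSpace ℝ (Fin 3) => (y 0 ^ 2 + y 1 ^ 2) * Ω y) = swirl w := by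
    funext y; rw [← cylRadius_sq]; exact hax.cylRadius_sq_mul_angVortQuot hu3 y
  have hD : fderiv ℝ (fun y : EuclideanSpace ℝ (Fin 3) => (y 0 ^ 2 + y 1 ^ 2) * Ω y) x h =
      2 * (x 0 * h 0 + x 1 * h 1) * Ω x + (x 0 ^ 2 + x 1 ^ 2) * fderiv ℝ Ω x h := by
    rw [fderiv_fun_mul (hasFDerivAt_horizSq x).differentiableAt (hΩd x)]
    simp only [_root_.add_apply, _root_.FunLike.coe_smul, Pi.smul_apply,
      smul_eq_mul, fderiv_horizSq_apply]
    ring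
  rw [hid] at hD
  -- bounds
  have hr0 := cylRadius_nonneg x
  have h1 : |fderiv ℝ (swirl w) x h| ≤ cylRadius x * ‖fderiv ℝ w x‖ + ‖w x‖ := by
    refine (abs_fderiv_swirl_le hwd x h).trans (add_le_add ?_ ?_)
    · refine mul_le_mul_of_nonneg_left ((ContinuousLinearMap.le_opNorm _ _).trans ?_) hr0
      calc ‖fderiv ℝ w x‖ * ‖h‖ ≤ ‖fderiv ℝ w x‖ * 1 := mul_le_mul_of_nonneg_left hh (norm_nonneg _)
        _ = _ := mul_one _
    · calc ‖h‖ * ‖w x‖ ≤ 1 * ‖w x‖ := mul_le_mul_of_nonneg_right hh (norm_nonneg _)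
        _ = _ := one_mul _
  have h2 : |2 * (x 0 * h 0 + x 1 * h 1) * Ω x| ≤ 2 * ‖w x‖ := by
    rw [abs_mul, abs_mul, abs_two]
    have hi : |x 0 * h 0 + x 1 * h 1| ≤ cylRadius x * ‖h‖ := abs_horizontal_inner_le x h
    have hP1 := hax.cylRadius_mul_abs_angVortQuot_le hu3 x
    calc 2 * |x 0 * h 0 + x 1 * h 1| * |Ω x| ≤ 2 * (cylRadius x * ‖h‖) * |Ω x| := by gcongr
      _ ≤ 2 * (cylRadius x * 1) * |Ω x| := by gcongr
      _ = 2 * (cylRadius x * |Ω x|) := by ring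
      _ ≤ 2 * ‖w x‖ := by linarith
  have h3 : (x 0 ^ 2 + x 1 ^ 2) * |fderiv ℝ Ω x h| ≤ cylRadius x * ‖fderiv ℝ w x‖ + 3 * ‖w x‖ := by
    have : (x 0 ^ 2 + x 1 ^ 2) * fderiv ℝ Ω x h = fderiv ℝ (swirl w) x h - 2 * (x 0 * h 0 + x 1 * h 1) * Ω x := by
      linarith [hD]
    rw [← abs_of_nonneg (by positivity : (0 : ℝ) ≤ x 0 ^ 2 + x 1 ^ 2), ← abs_mul, this]
    refine (abs_sub _ _).trans ?_
    linarith
  -- case split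
  rcases le_or_gt (cylRadius x) 1 with hle | hgt
  · calc cylRadius x * |fderiv ℝ Ω x h| ≤ 1 * |fderiv ℝ Ω x h| :=
          mul_le_mul_of_nonneg_right hle (abs_nonneg _)
      _ ≤ _ := by rw [one_mul]; linarith [norm_nonneg (w x), norm_nonneg (fderiv ℝ w x)]
  · have hr1 : 1 ≤ cylRadius x := hgt.le
    have key : cylRadius x * (cylRadius x * |fderiv ℝ Ω x h|) ≤
        cylRadius x * (3 * ‖w x‖ + ‖fderiv ℝ w x‖) := by
      rw [← mul_assoc, ← sq, cylRadius_sq]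
      calc (x 0 ^ 2 + x 1 ^ 2) * |fderiv ℝ Ω x h| ≤ cylRadius x * ‖fderiv ℝ w x‖ + 3 * ‖w x‖ := h3
        _ ≤ cylRadius x * ‖fderiv ℝ w x‖ + cylRadius x * (3 * ‖w x‖) := by
            nlinarith [norm_nonneg (w x)]
        _ = _ := by ring
    have := le_of_mul_le_mul_left key (by linarith)
    linarith [abs_nonneg (fderiv ℝ Ω x h)]

/-- **`|Ω| ρ |∂ₑ∂ₑΩ| ≤ |ω| |∇∂ₑω| + 2|Ω| |∇ω| + 2Ω² + 4|ω| |∂ₑΩ|`** (`‖e‖ ≤ 1`, `ρ = r²`,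
`ω = curl u`): differentiate `ρΩ = swirl ω` twice in the direction `e`,
`ρ∂ₑ∂ₑΩ = ⟪Jx, ∇(∂ₑω) e⟫ + 2⟪Je, ∂ₑω⟫ − 2(e₀² + e₁²)Ω − 4(x₀e₀ + x₁e₁)∂ₑΩ`, and use `r|Ω| ≤ |ω|`.
[folklore] -/
theorem IsAxisymmetric.abs_angVortQuot_mul_horizSq_mul_abs_fderiv_fderiv_le (hax : IsAxisymmetric u)
    (hu : ContDiff ℝ 5 u) {e : EuclideanSpace ℝ (Fin 3)} (he : ‖e‖ ≤ 1) (x : EuclideanSpace ℝ (Fin 3)) :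
    |angVortQuot u x| * ((x 0 ^ 2 + x 1 ^ 2) *
        |fderiv ℝ (fun y => fderiv ℝ (angVortQuot u) y e) x e|) ≤
      ‖FluidPDE.curl u x‖ * ‖fderiv ℝ (fun y => fderiv ℝ (FluidPDE.curl u) y e) x‖ +
        2 * |angVortQuot u x| * ‖fderiv ℝ (FluidPDE.curl u) x‖ + 2 * angVortQuot u x ^ 2 +
        4 * ‖FluidPDE.curl u x‖ * |fderiv ℝ (angVortQuot u) x e| := by
  set Ω := angVortQuot u with hΩ_def
  set w := FluidPDE.curl u with hw_def
  have hu3 : ContDiff ℝ 3 u := hu.of_le (by norm_cast)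
  have hwc : ContDiff ℝ 2 w := contDiff_curl (n := 2) (by exact_mod_cast hu.of_le (by norm_cast))
  have hwd : Differentiable ℝ w := hwc.differentiable (by norm_num)
  set w' : EuclideanSpace ℝ (Fin 3) → EuclideanSpace ℝ (Fin 3) := fun y => fderiv ℝ w y e with hw'_def
  have hw'c : ContDiff ℝ 1 w' := contDiff_fderiv_apply_vec3_of_contDiff' hwc e
  have hw'd : Differentiable ℝ w' := hw'c.differentiable one_ne_zero
  have hΩc : ContDiff ℝ 2 Ω := contDiff_angVortQuot (n := 2) (by exact_mod_cast hu)
  have hΩd : Differentiable ℝ Ω := hΩc.differentiable (by norm_num)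
  set Ωe : EuclideanSpace ℝ (Fin 3) → ℝ := fun y => fderiv ℝ Ω y e with hΩe_def
  have hΩec : ContDiff ℝ 1 Ωe := contDiff_fderiv_apply_vec3_of_contDiff' hΩc e
  have hΩed : Differentiable ℝ Ωe := hΩec.differentiable one_ne_zero
  -- the linear forms `s y = y₀e₀ + y₁e₁` and `ρ`
  set sL : EuclideanSpace ℝ (Fin 3) →L[ℝ] ℝ := (e 0) • EuclideanSpace.proj (𝕜 := ℝ) (ι := Fin 3) (0 : Fin 3) +
    (e 1) • EuclideanSpace.proj (𝕜 := ℝ) (ι := Fin 3) (1 : Fin 3) with hsL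
  have hproj : ∀ (i : Fin 3) (y : EuclideanSpace ℝ (Fin 3)), EuclideanSpace.proj (𝕜 := ℝ) (ι := Fin 3) i y = y i :=
    fun i y => rfl
  have hsL_apply : ∀ y : EuclideanSpace ℝ (Fin 3), sL y = y 0 * e 0 + y 1 * e 1 := fun y => by
    simp only [hsL, _root_.add_apply, _root_.FunLike.coe_smul, Pi.smul_apply, smul_eq_mul, hproj]; ring
  -- first derivative two ways, as functions
  have hid : (fun y : EuclideanSpace ℝ (Fin 3) => (y 0 ^ 2 + y 1 ^ 2) * Ω y) = swirl w := by
    funext y; rw [← cylRadius_sq]; exact hax.cylRadius_sq_mul_angVortQuot hu3 y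
  have hA : ∀ y, fderiv ℝ (fun z : EuclideanSpace ℝ (Fin 3) => (z 0 ^ 2 + z 1 ^ 2) * Ω z) y e =
      2 * sL y * Ω y + (y 0 ^ 2 + y 1 ^ 2) * Ωe y := by
    intro y
    rw [fderiv_fun_mul (hasFDerivAt_horizSq y).differentiableAt (hΩd y)]
    simp only [_root_.add_apply, _root_.FunLike.coe_smul, Pi.smul_apply, smul_eq_mul,
      fderiv_horizSq_apply, hsL_apply, hΩe_def]
    ring
  have hB : ∀ y, fderiv ℝ (swirl w) y e = swirl w' y + ⟪rotGen e, w y⟫ := by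
    intro y
    rw [fderiv_swirl_apply (hwd y) e, swirl_eq_inner_rotGen]
  have hAB : (fun y => 2 * sL y * Ω y + (y 0 ^ 2 + y 1 ^ 2) * Ωe y) = fun y => swirl w' y + ⟪rotGen e, w y⟫ := by
    funext y; rw [← hA, ← hB, hid]
  -- second derivative of representation A
  have dsL2 : DifferentiableAt ℝ (fun y => 2 * sL y) x := sL.differentiableAt.const_mul 2
  have hA2e : fderiv ℝ (fun y : EuclideanSpace ℝ (Fin 3) => 2 * sL y * Ω y + (y 0 ^ 2 + y 1 ^ 2) * Ωe y) x e =
      2 * (e 0 * e 0 + e 1 * e 1) * Ω x + 4 * sL x * Ωe x + (x 0 ^ 2 + x 1 ^ 2) * fderiv ℝ Ωe x e := by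
    have d1 : DifferentiableAt ℝ (fun y => 2 * sL y * Ω y) x := dsL2.mul (hΩd x)
    have d2 : DifferentiableAt ℝ (fun y : EuclideanSpace ℝ (Fin 3) => (y 0 ^ 2 + y 1 ^ 2) * Ωe y) x :=
      (hasFDerivAt_horizSq x).differentiableAt.mul (hΩed x)
    rw [fderiv_fun_add d1 d2,
      fderiv_fun_mul dsL2 (hΩd x), fderiv_fun_mul (hasFDerivAt_horizSq x).differentiableAt (hΩed x),
      fderiv_const_mul sL.differentiableAt, sL.fderiv]
    simp only [_root_.add_apply, _root_.FunLike.coe_smul, Pi.smul_apply, smul_eq_mul,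
      fderiv_horizSq_apply, hsL_apply]
    have : fderiv ℝ Ω x e = Ωe x := rfl
    rw [this]; ring
  -- second derivative of representation B
  have hB2e : fderiv ℝ (fun y => swirl w' y + ⟪rotGen e, w y⟫) x e =
      ⟪rotGen x, fderiv ℝ w' x e⟫ + 2 * ⟪rotGen e, w' x⟫ := by
    have dc : DifferentiableAt ℝ (fun _ : EuclideanSpace ℝ (Fin 3) => rotGen e) x := differentiableAt_const _
    have d3 : DifferentiableAt ℝ (fun y => ⟪rotGen e, w y⟫) x := dc.inner ℝ (hwd x)
    have d4 : DifferentiableAt ℝ (swirl w') x := differentiableAt_swirl (hw'd x)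
    rw [fderiv_fun_add d4 d3,
      _root_.add_apply, fderiv_swirl_apply (hw'd x) e, fderiv_inner_apply ℝ dc (hwd x),
      fderiv_const_apply]
    simp only [_root_.zero_apply, inner_zero_left, add_zero]
    have : fderiv ℝ w x e = w' x := rfl
    rw [this]; ring
  have hkey : (x 0 ^ 2 + x 1 ^ 2) * fderiv ℝ Ωe x e =
      ⟪rotGen x, fderiv ℝ w' x e⟫ + 2 * ⟪rotGen e, w' x⟫ - 2 * (e 0 * e 0 + e 1 * e 1) * Ω x - 4 * sL x * Ωe x := by
    have := hA2e
    rw [hAB, hB2e] at this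
    linarith
  -- bounds
  have hr0 := cylRadius_nonneg x
  have hP1 := hax.cylRadius_mul_abs_angVortQuot_le hu3 x
  have hee : e 0 * e 0 + e 1 * e 1 ≤ 1 := by
    have h1 : e 0 ^ 2 + e 1 ^ 2 ≤ ‖e‖ ^ 2 := by
      rw [EuclideanSpace.norm_sq_eq, Fin.sum_univ_three]
      simp only [Real.norm_eq_abs, sq_abs]; nlinarith [sq_nonneg (e 2)]
    have h2 : ‖e‖ ^ 2 ≤ 1 := by nlinarith [norm_nonneg e]
    nlinarith
  have hee0 : 0 ≤ e 0 * e 0 + e 1 * e 1 := by nlinarith [sq_nonneg (e 0), sq_nonneg (e 1)]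
  have hsx : |sL x| ≤ cylRadius x := by
    rw [hsL_apply]
    have := abs_horizontal_inner_le x e
    calc |x 0 * e 0 + x 1 * e 1| ≤ Real.sqrt (x 0 ^ 2 + x 1 ^ 2) * ‖e‖ := this
      _ ≤ Real.sqrt (x 0 ^ 2 + x 1 ^ 2) * 1 := mul_le_mul_of_nonneg_left he (Real.sqrt_nonneg _)
      _ = cylRadius x := mul_one _
  have hw'x : ‖w' x‖ ≤ ‖fderiv ℝ w x‖ := by
    simp only [hw'_def]
    calc ‖fderiv ℝ w x e‖ ≤ ‖fderiv ℝ w x‖ * ‖e‖ := ContinuousLinearMap.le_opNorm _ _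
      _ ≤ ‖fderiv ℝ w x‖ * 1 := mul_le_mul_of_nonneg_left he (norm_nonneg _)
      _ = _ := mul_one _
  have hDw'x : ‖fderiv ℝ w' x e‖ ≤ ‖fderiv ℝ w' x‖ := by
    calc ‖fderiv ℝ w' x e‖ ≤ ‖fderiv ℝ w' x‖ * ‖e‖ := ContinuousLinearMap.le_opNorm _ _
      _ ≤ ‖fderiv ℝ w' x‖ * 1 := mul_le_mul_of_nonneg_left he (norm_nonneg _)
      _ = _ := mul_one _
  have hJe : ‖rotGen e‖ ≤ 1 := (norm_rotGen_le_norm_aux e).trans he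
  have t1 : |⟪rotGen x, fderiv ℝ w' x e⟫| ≤ cylRadius x * ‖fderiv ℝ w' x‖ :=
    (abs_real_inner_le_norm _ _).trans (by
      rw [norm_rotGen_eq_cylRadius']; exact mul_le_mul_of_nonneg_left hDw'x hr0)
  have t2 : |2 * ⟪rotGen e, w' x⟫| ≤ 2 * ‖fderiv ℝ w x‖ := by
    rw [abs_mul, abs_two]
    refine mul_le_mul_of_nonneg_left ((abs_real_inner_le_norm _ _).trans ?_) (by norm_num)
    calc ‖rotGen e‖ * ‖w' x‖ ≤ 1 * ‖fderiv ℝ w x‖ := mul_le_mul hJe hw'x (norm_nonneg _) zero_le_one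
      _ = _ := one_mul _
  have t3 : |2 * (e 0 * e 0 + e 1 * e 1) * Ω x| ≤ 2 * |Ω x| := by
    rw [abs_mul, abs_mul, abs_two, abs_of_nonneg hee0]
    nlinarith [abs_nonneg (Ω x)]
  have t4 : |4 * sL x * Ωe x| ≤ 4 * cylRadius x * |Ωe x| := by
    rw [abs_mul, abs_mul, show |(4 : ℝ)| = 4 by norm_num]
    gcongr
  have hmain : (x 0 ^ 2 + x 1 ^ 2) * |fderiv ℝ Ωe x e| ≤
      cylRadius x * ‖fderiv ℝ w' x‖ + 2 * ‖fderiv ℝ w x‖ + 2 * |Ω x| + 4 * cylRadius x * |Ωe x| := by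
    rw [← abs_of_nonneg (by positivity : (0 : ℝ) ≤ x 0 ^ 2 + x 1 ^ 2), ← abs_mul, hkey]
    refine (abs_sub _ _).trans ?_
    refine (add_le_add (abs_sub _ _ |>.trans (add_le_add (abs_add_le _ _) le_rfl)) le_rfl).trans ?_
    linarith
  have hΩ0 := abs_nonneg (Ω x)
  calc |Ω x| * ((x 0 ^ 2 + x 1 ^ 2) * |fderiv ℝ Ωe x e|)
      ≤ |Ω x| * (cylRadius x * ‖fderiv ℝ w' x‖ + 2 * ‖fderiv ℝ w x‖ + 2 * |Ω x| + 4 * cylRadius x * |Ωe x|) :=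
        mul_le_mul_of_nonneg_left hmain hΩ0
    _ = (cylRadius x * |Ω x|) * ‖fderiv ℝ w' x‖ + 2 * |Ω x| * ‖fderiv ℝ w x‖ + 2 * (|Ω x| * |Ω x|) +
        4 * (cylRadius x * |Ω x|) * |Ωe x| := by ring
    _ ≤ ‖w x‖ * ‖fderiv ℝ w' x‖ + 2 * |Ω x| * ‖fderiv ℝ w x‖ + 2 * Ω x ^ 2 + 4 * ‖w x‖ * |Ωe x| := by
        rw [← abs_mul, abs_mul_self, ← sq]
        gcongr

end Pointwise

/-! ### The three integrated terms (generic, with explicit integrability provisos) -/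

section Terms

variable {G Φ : EuclideanSpace ℝ (Fin 3) → ℝ} {b : EuclideanSpace ℝ (Fin 3) → EuclideanSpace ℝ (Fin 3)}

/-- **Transport with the weight `ρ = x₀² + x₁²`**: `∫ ρ G ∇G·b = −∫ (x₀b₀ + x₁b₁) G²` for a bounded
div-free `C¹` drift with bounded gradient (`Σᵢ ∫ bᵢ ∂ᵢ(ρG²) = −∫ (div b) ρG² = 0`,
`∂ᵢ(ρG²) = ∂ᵢρ G² + 2ρG∂ᵢG`). [folklore] -/
theorem integral_horizSq_mul_mul_fderiv_apply_eq (hG : ContDiff ℝ 1 G) (hb : ContDiff ℝ 1 b)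
    (hdiv : VectorCalculus.IsDivFree b) {B : ℝ} (hbB : ∀ x, ‖b x‖ ≤ B) {B' : ℝ}
    (hDb : ∀ x, ‖fderiv ℝ b x‖ ≤ B')
    (iF : Integrable (fun x : EuclideanSpace ℝ (Fin 3) => (x 0 ^ 2 + x 1 ^ 2) * G x ^ 2) volume)
    (iX0 : Integrable (fun x : EuclideanSpace ℝ (Fin 3) => x 0 * G x ^ 2) volume)
    (iX1 : Integrable (fun x : EuclideanSpace ℝ (Fin 3) => x 1 * G x ^ 2) volume)
    (iP : ∀ i : Fin 3, Integrable (fun x : EuclideanSpace ℝ (Fin 3) =>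
      (x 0 ^ 2 + x 1 ^ 2) * G x * fderiv ℝ G x (EuclideanSpace.single i 1)) volume) :
    ∫ x, (x 0 ^ 2 + x 1 ^ 2) * G x * fderiv ℝ G x (b x) =
      -∫ x, (x 0 * b x 0 + x 1 * b x 1) * G x ^ 2 := by
  set e : Fin 3 → EuclideanSpace ℝ (Fin 3) := fun i => EuclideanSpace.single i 1 with he_def
  have he' : ∀ i, EuclideanSpace.single i (1 : ℝ) = e i := fun i => rfl
  simp only [he'] at iP ⊢
  have hGd : Differentiable ℝ G := hG.differentiable one_ne_zero
  have hbd : Differentiable ℝ b := hb.differentiable one_ne_zero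
  have hbi : ∀ i : Fin 3, ContDiff ℝ 1 fun x => b x i := fun i => contDiff_apply_coord_vec3 hb i
  have hbid : ∀ i : Fin 3, Differentiable ℝ fun x => b x i := fun i => (hbi i).differentiable one_ne_zero
  have hbiB : ∀ (i : Fin 3) x, ‖b x i‖ ≤ B := fun i x => (PiLp.norm_apply_le (b x) i).trans (hbB x)
  have hDbi : ∀ (i : Fin 3) x, fderiv ℝ (fun y => b y i) x (e i) = fderiv ℝ b x (e i) i := fun i x =>
    fderiv_apply_coord_vec3 (hbd x) i (e i)
  have hDbiB : ∀ (i : Fin 3) x, ‖fderiv ℝ (fun y => b y i) x (e i)‖ ≤ B' := fun i x => by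
    rw [hDbi]
    calc ‖fderiv ℝ b x (e i) i‖ ≤ ‖fderiv ℝ b x (e i)‖ := PiLp.norm_apply_le _ i
      _ ≤ ‖fderiv ℝ b x‖ * ‖e i‖ := (fderiv ℝ b x).le_opNorm _
      _ ≤ ‖fderiv ℝ b x‖ * 1 := by
          gcongr; exact norm_euclideanSpace_single_one_le i
      _ ≤ B' := by rw [mul_one]; exact hDb x
  -- `F = ρ G²` and its partial derivatives
  set F : EuclideanSpace ℝ (Fin 3) → ℝ := fun y => (y 0 ^ 2 + y 1 ^ 2) * G y ^ 2 with hF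
  have hFd : Differentiable ℝ F := (contDiff_horizSq (n := 1)).differentiable one_ne_zero |>.mul (hGd.pow 2)
  have hDF : ∀ (i : Fin 3) x, fderiv ℝ F x (e i) =
      2 * (x 0 * e i 0 + x 1 * e i 1) * G x ^ 2 + 2 * ((x 0 ^ 2 + x 1 ^ 2) * G x * fderiv ℝ G x (e i)) := by
    intro i x
    simp only [hF]
    have dG2 : DifferentiableAt ℝ (fun y => G y ^ 2) x := (hGd x).pow 2
    rw [fderiv_fun_mul (hasFDerivAt_horizSq x).differentiableAt dG2,
      _root_.add_apply, _root_.FunLike.coe_smul, _root_.FunLike.coe_smul, Pi.smul_apply, Pi.smul_apply,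
      smul_eq_mul, smul_eq_mul, fderiv_horizSq_apply, ((hGd x).hasFDerivAt.pow 2).fderiv]
    simp only [_root_.FunLike.coe_smul, Pi.smul_apply, smul_eq_mul]
    ring
  -- the coefficient functions `2(x₀ eᵢ₀ + x₁ eᵢ₁) G²`
  have hcoef : ∀ i : Fin 3, ∀ x : EuclideanSpace ℝ (Fin 3), 2 * (x 0 * e i 0 + x 1 * e i 1) * G x ^ 2 =
      2 * (e i 0 * (x 0 * G x ^ 2) + e i 1 * (x 1 * G x ^ 2)) := fun i x => by ring
  have iDF : ∀ i : Fin 3, Integrable (fun x => fderiv ℝ F x (e i)) volume := by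
    intro i
    have : (fun x => fderiv ℝ F x (e i)) = fun x =>
        2 * (e i 0 * (x 0 * G x ^ 2) + e i 1 * (x 1 * G x ^ 2)) + 2 * ((x 0 ^ 2 + x 1 ^ 2) * G x * fderiv ℝ G x (e i)) := by
      funext x; rw [hDF, hcoef]
    rw [this]
    exact (((iX0.const_mul _).add (iX1.const_mul _)).const_mul 2).add ((iP i).const_mul 2)
  -- integration by parts in each coordinate
  have key : ∀ {f g : EuclideanSpace ℝ (Fin 3) → ℝ} {C : ℝ}, Continuous f → (∀ x, ‖f x‖ ≤ C) →
      Integrable g volume → Integrable (fun x => f x * g x) volume :=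
    fun hf hC hg => hg.bdd_mul hf.aestronglyMeasurable (ae_of_all _ hC)
  have hIBP : ∀ i : Fin 3, ∫ x, b x i * fderiv ℝ F x (e i) = -∫ x, fderiv ℝ (fun y => b y i) x (e i) * F x := by
    intro i
    refine integral_mul_fderiv_eq_neg_fderiv_mul_of_integrable (μ := volume) (f := fun y => b y i) (g := F)
      (v := e i) ?_ ?_ ?_ (fun x _ => hbid i x) (fun x _ => hFd x)
    · exact key (((hbi i).continuous_fderiv one_ne_zero).clm_apply continuous_const) (hDbiB i) iF
    · exact key (hbi i).continuous (hbiB i) (iDF i)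
    · exact key (hbi i).continuous (hbiB i) iF
  -- `Σᵢ ∫ ∂ᵢbᵢ F = 0`
  have iB : ∀ i : Fin 3, Integrable (fun x => fderiv ℝ (fun y => b y i) x (e i) * F x) volume := fun i =>
    key (((hbi i).continuous_fderiv one_ne_zero).clm_apply continuous_const) (hDbiB i) iF
  have hdivint : (∫ x, fderiv ℝ (fun y => b y 0) x (e 0) * F x) + (∫ x, fderiv ℝ (fun y => b y 1) x (e 1) * F x) +
      (∫ x, fderiv ℝ (fun y => b y 2) x (e 2) * F x) = 0 := by
    have iB01 : Integrable (fun x => fderiv ℝ (fun y => b y 0) x (e 0) * F x +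
        fderiv ℝ (fun y => b y 1) x (e 1) * F x) volume := (iB 0).add (iB 1)
    rw [← integral_add (iB 0) (iB 1), ← integral_add iB01 (iB 2)]
    refine integral_eq_zero_of_ae (Eventually.of_forall fun x => ?_)
    have h := divergence_eq_sum_three b x
    rw [hdiv x] at h
    simp only [he'] at h
    simp only [Pi.zero_apply, hDbi]
    have : fderiv ℝ b x (e 0) 0 + fderiv ℝ b x (e 1) 1 + fderiv ℝ b x (e 2) 2 = 0 := h.symm
    calc fderiv ℝ b x (e 0) 0 * F x + fderiv ℝ b x (e 1) 1 * F x + fderiv ℝ b x (e 2) 2 * F x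
        = (fderiv ℝ b x (e 0) 0 + fderiv ℝ b x (e 1) 1 + fderiv ℝ b x (e 2) 2) * F x := by ring
      _ = 0 := by rw [this, zero_mul]
  -- `Σᵢ ∫ bᵢ ∂ᵢF = 2 ∫ (x₀b₀ + x₁b₁) G² + 2 ∫ ρ G ∇G·b`
  have iA : ∀ i : Fin 3, Integrable (fun x => b x i * fderiv ℝ F x (e i)) volume := fun i =>
    key (hbi i).continuous (hbiB i) (iDF i)
  have iQ : ∀ i : Fin 3, Integrable (fun x : EuclideanSpace ℝ (Fin 3) =>
      b x i * ((x 0 ^ 2 + x 1 ^ 2) * G x * fderiv ℝ G x (e i))) volume := fun i =>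
    key (hbi i).continuous (hbiB i) (iP i)
  have iR0 : Integrable (fun x : EuclideanSpace ℝ (Fin 3) => b x 0 * (x 0 * G x ^ 2)) volume :=
    key (hbi 0).continuous (hbiB 0) iX0
  have iR1 : Integrable (fun x : EuclideanSpace ℝ (Fin 3) => b x 1 * (x 1 * G x ^ 2)) volume :=
    key (hbi 1).continuous (hbiB 1) iX1
  have hsum : (∫ x, b x 0 * fderiv ℝ F x (e 0)) + (∫ x, b x 1 * fderiv ℝ F x (e 1)) + (∫ x, b x 2 * fderiv ℝ F x (e 2)) =
      2 * (∫ x : EuclideanSpace ℝ (Fin 3), (x 0 * b x 0 + x 1 * b x 1) * G x ^ 2) +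
        2 * ∫ x : EuclideanSpace ℝ (Fin 3), (x 0 ^ 2 + x 1 ^ 2) * G x * fderiv ℝ G x (b x) := by
    have iL : Integrable (fun x : EuclideanSpace ℝ (Fin 3) => (x 0 * b x 0 + x 1 * b x 1) * G x ^ 2) volume :=
      (iR0.add iR1).congr (ae_of_all _ fun x => by simp only [Pi.add_apply]; ring)
    have iM : Integrable (fun x : EuclideanSpace ℝ (Fin 3) => (x 0 ^ 2 + x 1 ^ 2) * G x * fderiv ℝ G x (b x)) volume := by
      refine (((iQ 0).add (iQ 1)).add (iQ 2)).congr (ae_of_all _ fun x => ?_)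
      simp only [Pi.add_apply]
      rw [fderiv_apply_eq_sum_three G x (b x)]
      simp only [he']; ring
    have iA01 : Integrable (fun x => b x 0 * fderiv ℝ F x (e 0) + b x 1 * fderiv ℝ F x (e 1)) volume :=
      (iA 0).add (iA 1)
    have iLM : Integrable (fun x : EuclideanSpace ℝ (Fin 3) => 2 * ((x 0 * b x 0 + x 1 * b x 1) * G x ^ 2) +
        2 * ((x 0 ^ 2 + x 1 ^ 2) * G x * fderiv ℝ G x (b x))) volume := (iL.const_mul 2).add (iM.const_mul 2)
    rw [← integral_add (iA 0) (iA 1), ← integral_add iA01 (iA 2), ← integral_const_mul,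
      ← integral_const_mul, ← integral_add (iL.const_mul 2) (iM.const_mul 2)]
    refine integral_congr_ae (ae_of_all _ fun x => ?_)
    simp only [hDF]
    rw [fderiv_apply_eq_sum_three G x (b x)]
    simp only [he']
    have h0 : e 0 0 = 1 := by simp [he_def]
    have h01 : e 0 1 = 0 := by simp [he_def]
    have h10 : e 1 0 = 0 := by simp [he_def]
    have h11 : e 1 1 = 1 := by simp [he_def]
    have h20 : e 2 0 = 0 := by simp [he_def]
    have h21 : e 2 1 = 0 := by simp [he_def]
    rw [h0, h01, h10, h11, h20, h21]
    ring
  have htot : (∫ x, b x 0 * fderiv ℝ F x (e 0)) + (∫ x, b x 1 * fderiv ℝ F x (e 1)) + (∫ x, b x 2 * fderiv ℝ F x (e 2)) = 0 := by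
    rw [hIBP 0, hIBP 1, hIBP 2]; linarith [hdivint]
  linarith [hsum, htot]

/-- **The weighted viscous term**: `∫ ρ G (ΔG + 2 q_G) = −∫ ρ |∇G|²` for an axisymmetric `C³` scalar
`G` (`ρ(Δ + (2/r)∂_r)G = ∇·(ρ∇G)`, then by parts), under the integrability of `ρ(∂ᵢG)²`,
`G ∂ᵢ(ρ∂ᵢG)`, `G ρ∂ᵢG`. [folklore] -/
theorem integral_horizSq_mul_mul_laplacian_add_eq (hG : ContDiff ℝ 3 G) (hax : IsAxisymmetricScalar G)
    (iA : ∀ i : Fin 3, Integrable (fun x : EuclideanSpace ℝ (Fin 3) =>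
      (x 0 ^ 2 + x 1 ^ 2) * fderiv ℝ G x (EuclideanSpace.single i 1) ^ 2) volume)
    (iB : ∀ i : Fin 3, Integrable (fun x : EuclideanSpace ℝ (Fin 3) => G x *
      fderiv ℝ (fun y : EuclideanSpace ℝ (Fin 3) => (y 0 ^ 2 + y 1 ^ 2) * fderiv ℝ G y (EuclideanSpace.single i 1)) x
        (EuclideanSpace.single i 1)) volume)
    (iC : ∀ i : Fin 3, Integrable (fun x : EuclideanSpace ℝ (Fin 3) => G x *
      ((x 0 ^ 2 + x 1 ^ 2) * fderiv ℝ G x (EuclideanSpace.single i 1))) volume) :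
    ∫ x, (x 0 ^ 2 + x 1 ^ 2) * G x * ((Δ G) x + 2 * radDerivQuot G x) =
      -∫ x, (x 0 ^ 2 + x 1 ^ 2) * (fderiv ℝ G x (EuclideanSpace.single 0 1) ^ 2 +
        fderiv ℝ G x (EuclideanSpace.single 1 1) ^ 2 + fderiv ℝ G x (EuclideanSpace.single 2 1) ^ 2) := by
  set e : Fin 3 → EuclideanSpace ℝ (Fin 3) := fun i => EuclideanSpace.single i 1 with he_def
  have he' : ∀ i, EuclideanSpace.single i (1 : ℝ) = e i := fun i => rfl
  simp only [he'] at iA iB iC ⊢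
  have hG2 : ContDiff ℝ 2 G := hG.of_le (by norm_cast)
  have hGd : Differentiable ℝ G := hG.differentiable (by norm_num)
  have hGi : ∀ i, ContDiff ℝ 2 fun y => fderiv ℝ G y (e i) := fun i => contDiff_fderiv_apply_vec3_of_contDiff' hG (e i)
  have hGid : ∀ i, Differentiable ℝ fun y => fderiv ℝ G y (e i) := fun i => (hGi i).differentiable (by norm_num)
  -- `gᵢ = ρ ∂ᵢG`
  have hgd : ∀ i, Differentiable ℝ fun y : EuclideanSpace ℝ (Fin 3) => (y 0 ^ 2 + y 1 ^ 2) * fderiv ℝ G y (e i) :=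
    fun i => ((contDiff_horizSq (n := 1)).differentiable one_ne_zero).mul (hGid i)
  have hDg : ∀ (i : Fin 3) x, fderiv ℝ (fun y : EuclideanSpace ℝ (Fin 3) => (y 0 ^ 2 + y 1 ^ 2) * fderiv ℝ G y (e i)) x (e i) =
      2 * (x 0 * e i 0 + x 1 * e i 1) * fderiv ℝ G x (e i) +
        (x 0 ^ 2 + x 1 ^ 2) * fderiv ℝ (fun y => fderiv ℝ G y (e i)) x (e i) := by
    intro i x
    rw [fderiv_fun_mul (hasFDerivAt_horizSq x).differentiableAt (hGid i x), _root_.add_apply,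
      _root_.FunLike.coe_smul, _root_.FunLike.coe_smul, Pi.smul_apply, Pi.smul_apply, smul_eq_mul, smul_eq_mul,
      fderiv_horizSq_apply]
    ring
  -- pointwise: `ρ(ΔG + 2q) = Σᵢ ∂ᵢgᵢ`
  have hhor : ∀ x : EuclideanSpace ℝ (Fin 3), x 0 * fderiv ℝ G x (e 0) + x 1 * fderiv ℝ G x (e 1) =
      (x 0 ^ 2 + x 1 ^ 2) * radDerivQuot G x := by
    intro x
    have := fderiv_apply_horizontal_eq hG2 hax x
    rw [map_add, map_smul, map_smul, smul_eq_mul, smul_eq_mul, cylRadius_sq] at this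
    simpa only [he'] using this
  have hpt : ∀ x : EuclideanSpace ℝ (Fin 3), (x 0 ^ 2 + x 1 ^ 2) * G x * ((Δ G) x + 2 * radDerivQuot G x) =
      G x * fderiv ℝ (fun y : EuclideanSpace ℝ (Fin 3) => (y 0 ^ 2 + y 1 ^ 2) * fderiv ℝ G y (e 0)) x (e 0) +
      G x * fderiv ℝ (fun y : EuclideanSpace ℝ (Fin 3) => (y 0 ^ 2 + y 1 ^ 2) * fderiv ℝ G y (e 1)) x (e 1) +
      G x * fderiv ℝ (fun y : EuclideanSpace ℝ (Fin 3) => (y 0 ^ 2 + y 1 ^ 2) * fderiv ℝ G y (e 2)) x (e 2) := by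
    intro x
    rw [hDg, hDg, hDg, laplacian_eq_sum_fderiv_fderiv (EuclideanSpace.basisFun (Fin 3) ℝ) hG2 x]
    simp only [EuclideanSpace.basisFun_apply, Fin.sum_univ_three, he']
    have h0 : e 0 0 = 1 := by simp [he_def]
    have h01 : e 0 1 = 0 := by simp [he_def]
    have h10 : e 1 0 = 0 := by simp [he_def]
    have h11 : e 1 1 = 1 := by simp [he_def]
    have h20 : e 2 0 = 0 := by simp [he_def]
    have h21 : e 2 1 = 0 := by simp [he_def]
    rw [h0, h01, h10, h11, h20, h21]
    linear_combination (-2 * G x) * hhor x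
  -- by parts in each coordinate
  have hI : ∀ i : Fin 3, ∫ x, G x * fderiv ℝ (fun y : EuclideanSpace ℝ (Fin 3) => (y 0 ^ 2 + y 1 ^ 2) * fderiv ℝ G y (e i)) x (e i) =
      -∫ x : EuclideanSpace ℝ (Fin 3), (x 0 ^ 2 + x 1 ^ 2) * fderiv ℝ G x (e i) ^ 2 := by
    intro i
    have h := integral_mul_fderiv_eq_neg_fderiv_mul_of_integrable (μ := volume) (f := G)
      (g := fun y : EuclideanSpace ℝ (Fin 3) => (y 0 ^ 2 + y 1 ^ 2) * fderiv ℝ G y (e i)) (v := e i)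
      ((iA i).congr (ae_of_all _ fun x => by simp only; ring)) (iB i) (iC i)
      (fun x _ => hGd x) (fun x _ => hgd i x)
    rw [h]
    congr 1
    exact integral_congr_ae (ae_of_all _ fun x => by simp only; ring)
  have iB01 : Integrable (fun x => G x * fderiv ℝ (fun y : EuclideanSpace ℝ (Fin 3) => (y 0 ^ 2 + y 1 ^ 2) * fderiv ℝ G y (e 0)) x (e 0) +
      G x * fderiv ℝ (fun y : EuclideanSpace ℝ (Fin 3) => (y 0 ^ 2 + y 1 ^ 2) * fderiv ℝ G y (e 1)) x (e 1)) volume :=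
    (iB 0).add (iB 1)
  have iA01 : Integrable (fun x : EuclideanSpace ℝ (Fin 3) => (x 0 ^ 2 + x 1 ^ 2) * fderiv ℝ G x (e 0) ^ 2 +
      (x 0 ^ 2 + x 1 ^ 2) * fderiv ℝ G x (e 1) ^ 2) volume := (iA 0).add (iA 1)
  rw [integral_congr_ae (ae_of_all _ hpt), integral_add iB01 (iB 2), integral_add (iB 0) (iB 1), hI 0, hI 1, hI 2,
    ← neg_add, ← neg_add, ← integral_add (iA 0) (iA 1), ← integral_add iA01 (iA 2)]
  congr 1
  exact integral_congr_ae (ae_of_all _ fun x => by beta_reduce; ring)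

/-- **The weighted source term**: `2 ∫ ρ Ω Φ ∂_zΦ = −∫ ρ ∂_zΩ Φ² ≤ ½ ∫ ρ (∂_zΩ)² + ½ ∫ ρ Φ⁴`
(`∂_z ρ = 0`; by parts in `z`, then `−ρab ≤ ½ρ(a² + b²)`). [folklore] -/
theorem two_mul_integral_horizSq_mul_mul_mul_fderiv_le {Ω : EuclideanSpace ℝ (Fin 3) → ℝ}
    (hΩ : ContDiff ℝ 1 Ω) (hΦ : ContDiff ℝ 1 Φ)
    (i1 : Integrable (fun x : EuclideanSpace ℝ (Fin 3) => (x 0 ^ 2 + x 1 ^ 2) *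
      fderiv ℝ Ω x (EuclideanSpace.single 2 1) * Φ x ^ 2) volume)
    (i2 : Integrable (fun x : EuclideanSpace ℝ (Fin 3) => (x 0 ^ 2 + x 1 ^ 2) * Ω x *
      (Φ x * fderiv ℝ Φ x (EuclideanSpace.single 2 1))) volume)
    (i3 : Integrable (fun x : EuclideanSpace ℝ (Fin 3) => (x 0 ^ 2 + x 1 ^ 2) * Ω x * Φ x ^ 2) volume)
    (i4 : Integrable (fun x : EuclideanSpace ℝ (Fin 3) => (x 0 ^ 2 + x 1 ^ 2) *
      fderiv ℝ Ω x (EuclideanSpace.single 2 1) ^ 2) volume)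
    (i5 : Integrable (fun x : EuclideanSpace ℝ (Fin 3) => (x 0 ^ 2 + x 1 ^ 2) * Φ x ^ 4) volume) :
    2 * ∫ x : EuclideanSpace ℝ (Fin 3), (x 0 ^ 2 + x 1 ^ 2) * Ω x * (Φ x * fderiv ℝ Φ x (EuclideanSpace.single 2 1)) ≤
      1 / 2 * (∫ x : EuclideanSpace ℝ (Fin 3), (x 0 ^ 2 + x 1 ^ 2) * fderiv ℝ Ω x (EuclideanSpace.single 2 1) ^ 2) +
        1 / 2 * ∫ x : EuclideanSpace ℝ (Fin 3), (x 0 ^ 2 + x 1 ^ 2) * Φ x ^ 4 := by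
  set e : EuclideanSpace ℝ (Fin 3) := EuclideanSpace.single 2 1 with he
  have hΩd : Differentiable ℝ Ω := hΩ.differentiable one_ne_zero
  have hΦd : Differentiable ℝ Φ := hΦ.differentiable one_ne_zero
  set f : EuclideanSpace ℝ (Fin 3) → ℝ := fun y => (y 0 ^ 2 + y 1 ^ 2) * Ω y with hf
  have hfd : Differentiable ℝ f := ((contDiff_horizSq (n := 1)).differentiable one_ne_zero).mul hΩd
  have hgd : Differentiable ℝ fun y => Φ y ^ 2 := hΦd.pow 2
  have he0 : e 0 = 0 := by simp [he]
  have he1 : e 1 = 0 := by simp [he]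
  have hDf : ∀ x, fderiv ℝ f x e = (x 0 ^ 2 + x 1 ^ 2) * fderiv ℝ Ω x e := by
    intro x
    simp only [hf]
    rw [fderiv_fun_mul (hasFDerivAt_horizSq x).differentiableAt (hΩd x), _root_.add_apply,
      _root_.FunLike.coe_smul, _root_.FunLike.coe_smul, Pi.smul_apply, Pi.smul_apply, smul_eq_mul, smul_eq_mul,
      fderiv_horizSq_apply, he0, he1]
    ring
  have hDg : ∀ x, fderiv ℝ (fun y => Φ y ^ 2) x e = 2 * Φ x * fderiv ℝ Φ x e := by
    intro x
    rw [((hΦd x).hasFDerivAt.pow 2).fderiv]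
    simp only [_root_.FunLike.coe_smul, Pi.smul_apply, smul_eq_mul]
    ring
  have if'g : Integrable (fun x => fderiv ℝ f x e * Φ x ^ 2) volume :=
    i1.congr (ae_of_all _ fun x => by simp only [hDf])
  have ifg' : Integrable (fun x => f x * fderiv ℝ (fun y => Φ y ^ 2) x e) volume :=
    (i2.const_mul 2).congr (ae_of_all _ fun x => by simp only [hDg, hf]; ring)
  have ifg : Integrable (fun x => f x * Φ x ^ 2) volume := i3.congr (ae_of_all _ fun x => by simp only [hf])
  have hibp := integral_mul_fderiv_eq_neg_fderiv_mul_of_integrable (μ := volume) (f := f)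
    (g := fun y => Φ y ^ 2) (v := e) if'g ifg' ifg (fun x _ => hfd x) (fun x _ => hgd x)
  have h2 : 2 * ∫ x : EuclideanSpace ℝ (Fin 3), (x 0 ^ 2 + x 1 ^ 2) * Ω x * (Φ x * fderiv ℝ Φ x e) =
      ∫ x, f x * fderiv ℝ (fun y => Φ y ^ 2) x e := by
    rw [← integral_const_mul]
    exact integral_congr_ae (ae_of_all _ fun x => by simp only [hDg, hf]; ring)
  rw [h2, hibp]
  have hmono : ∫ x, -(fderiv ℝ f x e * Φ x ^ 2) ≤
      ∫ x : EuclideanSpace ℝ (Fin 3), (1 / 2 * ((x 0 ^ 2 + x 1 ^ 2) * fderiv ℝ Ω x e ^ 2) +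
        1 / 2 * ((x 0 ^ 2 + x 1 ^ 2) * Φ x ^ 4)) :=
    integral_mono if'g.neg ((i4.const_mul _).add (i5.const_mul _)) fun x => by
      beta_reduce
      rw [hDf]
      have hρ : (0 : ℝ) ≤ x 0 ^ 2 + x 1 ^ 2 := by positivity
      nlinarith [mul_nonneg hρ (sq_nonneg (fderiv ℝ Ω x e + Φ x ^ 2))]
  rw [integral_neg] at hmono
  rw [integral_add (i4.const_mul _) (i5.const_mul _), integral_const_mul, integral_const_mul] at hmono
  exact hmono

end Terms

/-! ### The `ω^θ`-slice inequality in Tao's class -/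

section Slice

variable {T : ℝ} {u₀ : EuclideanSpace ℝ (Fin 3) → EuclideanSpace ℝ (Fin 3)}
  {u : ℝ → EuclideanSpace ℝ (Fin 3) → EuclideanSpace ℝ (Fin 3)} {p : ℝ → EuclideanSpace ℝ (Fin 3) → ℝ}

/-- `L²` membership from a bound `‖g‖ ≤ c ‖F‖` with `‖F‖ ∈ L²`. [folklore] -/
theorem memLp_of_norm_le_const_mul {G H : Type*} [NormedAddCommGroup G] [NormedAddCommGroup H]
    {g : EuclideanSpace ℝ (Fin 3) → G} {F : EuclideanSpace ℝ (Fin 3) → H} (hg : Continuous g) {c : ℝ}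
    (hc : 0 ≤ c) (hle : ∀ x, ‖g x‖ ≤ c * ‖F x‖) (hF : MemLp (fun x => ‖F x‖) 2 volume) :
    MemLp g 2 volume := by
  refine (hF.const_mul c).of_le hg.aestronglyMeasurable (ae_of_all _ fun x => ?_)
  rw [Real.norm_eq_abs, abs_mul, abs_of_nonneg hc, abs_norm]
  exact hle x

/-- `(a + b + c)² ≤ 3(a² + b² + c²)`. [folklore] -/
private theorem sq_add_three_le_aux (a b c : ℝ) : (a + b + c) ^ 2 ≤ 3 * (a ^ 2 + b ^ 2 + c ^ 2) := by
  nlinarith [sq_nonneg (a - b), sq_nonneg (b - c), sq_nonneg (a - c)]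
set_option maxHeartbeats 400000 in -- buildfix (bf3-g26): 160k/180k FAIL, 200k PASS at accept time; line-neutral budget line
/-- **The `ω^θ`-energy inequality at a fixed time** (Tao's class, `ν = 1`): for a Tao-class solution
with axisymmetric slices, `τ ∈ [0, T]`, and any bound `|vʳ/r| = |radVelQuot (u τ)| ≤ W_∞`,
`2 ∫ r²Ω Ω' ≤ 2 W_∞ ∫ r²Ω² + ∫ r²Φ⁴` (`r²Ω² = (ω^θ)²`, `r²Φ⁴ = (v^θ)⁴/r² = V⁴`,
`Ω' = angVortQuot (∂ₜu τ)`), i.e. `d/dt ‖ω^θ‖² ≤ 2‖vʳ/r‖_∞ ‖ω^θ‖² + ‖V²‖²`: the `ω^θ`-estimate that,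
after Lei–Zhang's bound of `‖V²‖² + ‖Ω‖²`, controls `‖ω^θ(t)‖_{L²}` by Grönwall.
[cite: LeiZhang2017, §4 (p. 10), after (7-3)] -/
theorem IsTaoSolutionOn.omegaTheta_slice_le (h : IsTaoSolutionOn T 1 u₀ u p) (hT : 0 < T)
    (hax : ∀ t ∈ Icc 0 T, IsAxisymmetric (u t)) {τ : ℝ} (hτ : τ ∈ Icc 0 T)
    {Wsup : ℝ} (hWsup : ∀ x, |radVelQuot (u τ) x| ≤ Wsup) :
    2 * ∫ x : EuclideanSpace ℝ (Fin 3), (x 0 ^ 2 + x 1 ^ 2) * angVortQuot (u τ) x *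
        angVortQuot (FluidPDE.timeDerivWithin (Icc 0 T) u τ) x ≤
      2 * Wsup * (∫ x : EuclideanSpace ℝ (Fin 3), (x 0 ^ 2 + x 1 ^ 2) * angVortQuot (u τ) x ^ 2) +
        ∫ x : EuclideanSpace ℝ (Fin 3), (x 0 ^ 2 + x 1 ^ 2) * angVelQuot (u τ) x ^ 4 := by
  -- abbreviations
  set e : Fin 3 → EuclideanSpace ℝ (Fin 3) := fun i => EuclideanSpace.single i 1 with he_def
  have he' : ∀ i, EuclideanSpace.single i (1 : ℝ) = e i := fun i => rfl
  set Φ : EuclideanSpace ℝ (Fin 3) → ℝ := angVelQuot (u τ) with hΦ_def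
  set Ω : EuclideanSpace ℝ (Fin 3) → ℝ := angVortQuot (u τ) with hΩ_def
  set W : EuclideanSpace ℝ (Fin 3) → ℝ := radVelQuot (u τ) with hW_def
  set Ω' : EuclideanSpace ℝ (Fin 3) → ℝ := angVortQuot (FluidPDE.timeDerivWithin (Icc 0 T) u τ) with hΩ'_def
  set ρ : EuclideanSpace ℝ (Fin 3) → ℝ := fun y => y 0 ^ 2 + y 1 ^ 2 with hρ_def
  have hρ' : ∀ x : EuclideanSpace ℝ (Fin 3), x 0 ^ 2 + x 1 ^ 2 = ρ x := fun x => rfl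
  have hρr : ∀ x, ρ x = cylRadius x ^ 2 := fun x => by rw [cylRadius_sq]
  have hρ0 : ∀ x, 0 ≤ ρ x := fun x => by rw [hρr]; exact sq_nonneg _
  simp only [hρ']
  -- Tao-class facts at `τ`
  have hcl := h.classical
  have hsm : IsSmoothSpaceTimeOn (Icc 0 T) u := hcl.smooth_velocity
  have hU : UniqueDiffOn ℝ (Icc 0 T) := uniqueDiffOn_Icc hT
  have hIcl : Icc 0 T ⊆ closure (interior (Icc 0 T)) := by rw [interior_Icc, closure_Ioo hT.ne]
  have hu : ContDiff ℝ ∞ (u τ) := hcl.contDiff_velocity hτ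
  have hu5 : ContDiff ℝ 5 (u τ) := hu.of_le (by norm_cast)
  have hu4 : ContDiff ℝ 4 (u τ) := hu.of_le (by norm_cast)
  have hu3 : ContDiff ℝ 3 (u τ) := hu.of_le (by norm_cast)
  have hu2 : ContDiff ℝ 2 (u τ) := hu.of_le (by norm_cast)
  have hu1 : ContDiff ℝ 1 (u τ) := hu.of_le (by norm_cast)
  have haxτ : IsAxisymmetric (u τ) := hax τ hτ
  have hdiv : VectorCalculus.IsDivFree (u τ) := hcl.divFree τ hτ
  have hH : ∀ n : ℕ, ∫⁻ x, ‖iteratedFDeriv ℝ n (u τ) x‖ₑ ^ 2 < ⊤ := fun n => by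
    obtain ⟨C, hC⟩ := h.sobolev n; exact (hC τ hτ).trans_lt ENNReal.coe_lt_top
  have hut : ContDiff ℝ ∞ (FluidPDE.timeDerivWithin (Icc 0 T) u τ) := hsm.contDiff_timeDerivWithin_slice hU hτ
  have hut3 : ContDiff ℝ 3 (FluidPDE.timeDerivWithin (Icc 0 T) u τ) := hut.of_le (by norm_cast)
  have haxt : IsAxisymmetric (FluidPDE.timeDerivWithin (Icc 0 T) u τ) := hsm.isAxisymmetric_timeDerivWithin hax hτ
  have hHt : ∀ n : ℕ, ∫⁻ x, ‖iteratedFDeriv ℝ n (FluidPDE.timeDerivWithin (Icc 0 T) u τ) x‖ₑ ^ 2 < ⊤ := fun n => by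
    obtain ⟨C, hC⟩ := h.sobolev_dt n; exact (hC τ hτ).trans_lt ENNReal.coe_lt_top
  obtain ⟨B, -, hB⟩ := h.exists_bound_velocity
  obtain ⟨B1, -, hB1⟩ := h.sobolev.exists_forall_norm_iteratedFDeriv_le (fun t ht => hcl.contDiff_velocity ht) 1
  have hDb : ∀ x, ‖fderiv ℝ (u τ) x‖ ≤ B1 := fun x => by
    have := hB1 τ hτ x
    rwa [← norm_iteratedFDeriv_fderiv (n := 0), norm_iteratedFDeriv_zero] at this
  have hB0 : 0 ≤ B := (norm_nonneg _).trans (hB τ hτ 0)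
  -- the quotients and the vorticities
  have hΦ : ContDiff ℝ ∞ Φ := contDiff_angVelQuot_of_contDiff hu
  have hΩ : ContDiff ℝ ∞ Ω := contDiff_angVortQuot_of_contDiff hu
  have hW : ContDiff ℝ ∞ W := contDiff_radVelQuot_of_contDiff hu
  set w : EuclideanSpace ℝ (Fin 3) → EuclideanSpace ℝ (Fin 3) := FluidPDE.curl (u τ) with hw_def
  set wt : EuclideanSpace ℝ (Fin 3) → EuclideanSpace ℝ (Fin 3) := FluidPDE.curl (FluidPDE.timeDerivWithin (Icc 0 T) u τ)
    with hwt_def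
  have hwC : ContDiff ℝ ∞ w := contDiff_curl (n := (⊤ : ℕ∞)) (by exact_mod_cast hu)
  have hwtC : ContDiff ℝ ∞ wt := contDiff_curl (n := (⊤ : ℕ∞)) (by exact_mod_cast hut)
  have hΦfin := haxτ.lintegral_sq_iteratedFDeriv_angVelQuot_lt_top hu hH
  have hΩfin := haxτ.lintegral_sq_iteratedFDeriv_angVortQuot_lt_top hu hH
  have hΩ'fin := haxt.lintegral_sq_iteratedFDeriv_angVortQuot_lt_top hut hHt
  have hne := norm_euclideanSpace_single_one_le
  have m0Φ : MemLp Φ 2 volume := memLp_of_sobolev hΦ hΦfin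
  have m1Φ : ∀ i, MemLp (fun x => fderiv ℝ Φ x (e i)) 2 volume := fun i =>
    memLp_fderiv_apply_of_sobolev hΦ hΦfin (hne i)
  have m0Ω : MemLp Ω 2 volume := memLp_of_sobolev hΩ hΩfin
  have m1Ω : ∀ i, MemLp (fun x => fderiv ℝ Ω x (e i)) 2 volume := fun i =>
    memLp_fderiv_apply_of_sobolev hΩ hΩfin (hne i)
  have mΩ' : MemLp Ω' 2 volume := memLp_of_sobolev (contDiff_angVortQuot_of_contDiff hut) hΩ'fin
  -- `L²` norms of the Sobolev scale of `u`, `∂ₜu`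
  have mD : ∀ n : ℕ, MemLp (fun x => ‖iteratedFDeriv ℝ n (u τ) x‖) 2 volume := fun n =>
    memLp_two_of_norm_le_of_lintegral (hu.continuous_iteratedFDeriv (by exact_mod_cast le_top)).norm
      (fun x => by rw [norm_norm]) (hH n)
  have mDt : ∀ n : ℕ, MemLp (fun x => ‖iteratedFDeriv ℝ n (FluidPDE.timeDerivWithin (Icc 0 T) u τ) x‖) 2 volume :=
    fun n => memLp_two_of_norm_le_of_lintegral (hut.continuous_iteratedFDeriv (by exact_mod_cast le_top)).norm
      (fun x => by rw [norm_norm]) (hHt n)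
  set c : ℝ := ‖(curlCLM : (EuclideanSpace ℝ (Fin 3) →L[ℝ] EuclideanSpace ℝ (Fin 3)) →L[ℝ]
      EuclideanSpace ℝ (Fin 3))‖ with hc_def
  have hc0 : 0 ≤ c := by positivity
  have mw0 : MemLp (fun x => ‖w x‖) 2 volume := by
    refine memLp_of_norm_le_const_mul hwC.continuous.norm hc0 (fun x => ?_) (mD 1)
    rw [norm_norm]
    have := norm_iteratedFDeriv_curl_le (n := 0) (by exact_mod_cast hu1) x
    rwa [norm_iteratedFDeriv_zero] at this
  have mw1 : MemLp (fun x => ‖fderiv ℝ w x‖) 2 volume := by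
    refine memLp_of_norm_le_const_mul (hwC.continuous_fderiv (by simp)).norm hc0 (fun x => ?_) (mD 2)
    rw [norm_norm]
    have := norm_iteratedFDeriv_curl_le (n := 1) (by exact_mod_cast hu2) x
    rwa [← norm_iteratedFDeriv_fderiv (n := 0), norm_iteratedFDeriv_zero] at this
  have mw2 : ∀ i, MemLp (fun x => ‖fderiv ℝ (fun y => fderiv ℝ w y (e i)) x‖) 2 volume := by
    intro i
    have hwi : ContDiff ℝ ∞ fun y => fderiv ℝ w y (e i) := contDiff_fderiv_apply_vec3_of_contDiff hwC (e i)
    refine memLp_of_norm_le_const_mul (hwi.continuous_fderiv (by simp)).norm hc0 (fun x => ?_) (mD 3)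
    rw [norm_norm]
    have h1 := norm_iteratedFDeriv_fderiv_apply_le_vec3 hwC (e i) 1 x
    rw [norm_iteratedFDeriv_fderiv (n := 0) |>.symm, norm_iteratedFDeriv_zero] at h1
    have h2 := norm_iteratedFDeriv_curl_le (n := 2) (by exact_mod_cast hu3) x
    calc ‖fderiv ℝ (fun y => fderiv ℝ w y (e i)) x‖ ≤ ‖e i‖ * ‖iteratedFDeriv ℝ 2 w x‖ := h1
      _ ≤ 1 * ‖iteratedFDeriv ℝ 2 w x‖ := mul_le_mul_of_nonneg_right (hne i) (norm_nonneg _)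
      _ ≤ c * ‖iteratedFDeriv ℝ 3 (u τ) x‖ := by rw [one_mul]; exact h2
  have mwt0 : MemLp (fun x => ‖wt x‖) 2 volume := by
    refine memLp_of_norm_le_const_mul hwtC.continuous.norm hc0 (fun x => ?_) (mDt 1)
    rw [norm_norm]
    have := norm_iteratedFDeriv_curl_le (n := 0) (by exact_mod_cast hut.of_le (by norm_cast)) x
    rwa [norm_iteratedFDeriv_zero] at this
  -- pointwise weighted bounds
  have P1 : ∀ x, cylRadius x * |Ω x| ≤ ‖w x‖ := fun x => haxτ.cylRadius_mul_abs_angVortQuot_le hu3 x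
  have P1t : ∀ x, cylRadius x * |Ω' x| ≤ ‖wt x‖ := fun x => haxt.cylRadius_mul_abs_angVortQuot_le hut3 x
  have P1Φ : ∀ x, cylRadius x * |Φ x| ≤ B := fun x =>
    (haxτ.cylRadius_mul_abs_angVelQuot_le hu2 x).trans (hB τ hτ x)
  have P2 : ∀ i x, cylRadius x * |fderiv ℝ Ω x (e i)| ≤ |fderiv ℝ Ω x (e i)| + 3 * ‖w x‖ + ‖fderiv ℝ w x‖ :=
    fun i x => haxτ.cylRadius_mul_abs_fderiv_angVortQuot_le hu4 (hne i) x
  have P4 : ∀ i x, |Ω x| * (ρ x * |fderiv ℝ (fun y => fderiv ℝ Ω y (e i)) x (e i)|) ≤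
      ‖w x‖ * ‖fderiv ℝ (fun y => fderiv ℝ w y (e i)) x‖ + 2 * |Ω x| * ‖fderiv ℝ w x‖ + 2 * Ω x ^ 2 +
        4 * ‖w x‖ * |fderiv ℝ Ω x (e i)| := fun i x =>
    haxτ.abs_angVortQuot_mul_horizSq_mul_abs_fderiv_fderiv_le hu5 (hne i) x
  have hρB : ∀ x, ρ x * Φ x ^ 2 ≤ B ^ 2 := fun x => by
    rw [hρr, ← mul_pow, ← sq_abs (cylRadius x * Φ x), abs_mul, abs_of_nonneg (cylRadius_nonneg x)]
    exact pow_le_pow_left₀ (mul_nonneg (cylRadius_nonneg x) (abs_nonneg _)) (P1Φ x) 2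
  ------------------------------------------------------------------
  -- integrability of the weighted integrands
  ------------------------------------------------------------------
  have cΩ := hΩ.continuous
  have cΦ := hΦ.continuous
  have cW := hW.continuous
  have cρ : Continuous ρ := (contDiff_horizSq (n := 0)).continuous
  have cDΩ : ∀ v, Continuous fun x => fderiv ℝ Ω x v := fun v => (hΩ.continuous_fderiv (by simp)).clm_apply continuous_const
  have cDΦ : ∀ v, Continuous fun x => fderiv ℝ Φ x v := fun v => (hΦ.continuous_fderiv (by simp)).clm_apply continuous_const
  have cΩ' : Continuous Ω' := (contDiff_angVortQuot_of_contDiff hut).continuous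
  have cDDΩ : ∀ i, Continuous fun x => fderiv ℝ (fun y => fderiv ℝ Ω y (e i)) x (e i) := fun i =>
    ((contDiff_fderiv_apply_vec3_of_contDiff hΩ (e i)).continuous_fderiv (by simp)).clm_apply continuous_const
  have mono : ∀ {f g : EuclideanSpace ℝ (Fin 3) → ℝ}, Continuous f → Integrable g volume →
      (∀ x, |f x| ≤ g x) → Integrable f volume := fun hf hg hle =>
    hg.mono' hf.aestronglyMeasurable (ae_of_all _ fun x => by rw [Real.norm_eq_abs]; exact hle x)
  -- `ρ Ω²`
  have iF : Integrable (fun x => ρ x * Ω x ^ 2) volume := by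
    refine mono (cρ.mul (cΩ.pow 2)) mw0.integrable_sq fun x => ?_
    rw [abs_of_nonneg (mul_nonneg (hρ0 x) (sq_nonneg _)), hρr,
      show cylRadius x ^ 2 * Ω x ^ 2 = (cylRadius x * |Ω x|) ^ 2 by rw [mul_pow, sq_abs]]
    exact pow_le_pow_left₀ (mul_nonneg (cylRadius_nonneg x) (abs_nonneg _)) (P1 x) 2
  -- `xᵢ Ω²`
  have iX : ∀ i : Fin 3, i = 0 ∨ i = 1 → Integrable (fun x => x i * Ω x ^ 2) volume := by
    intro i hi
    refine mono ((contDiff_piLp_apply (𝕜 := ℝ) (p := 2) (n := 0) (i := i)).continuous.mul (cΩ.pow 2))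
      (mw0.integrable_mul m0Ω.abs) fun x => ?_
    rw [abs_mul, show |Ω x ^ 2| = |Ω x| * |Ω x| by rw [abs_pow, sq], ← mul_assoc]
    exact mul_le_mul_of_nonneg_right (((mul_le_mul_of_nonneg_right (abs_coord_le_cylRadius x hi)
      (abs_nonneg _))).trans (P1 x)) (abs_nonneg _)
  -- `ρ Ω ∂ᵢΩ`
  have iP : ∀ i, Integrable (fun x => ρ x * Ω x * fderiv ℝ Ω x (e i)) volume := by
    intro i
    have ig : Integrable (fun x => ‖w x‖ * |fderiv ℝ Ω x (e i)| + 3 * (‖w x‖ * ‖w x‖) + ‖w x‖ * ‖fderiv ℝ w x‖) volume :=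
      ((mw0.integrable_mul (m1Ω i).abs).add ((mw0.integrable_mul mw0).const_mul 3)).add (mw0.integrable_mul mw1)
    refine mono ((cρ.mul cΩ).mul (cDΩ _)) ig fun x => ?_
    have h1 := P1 x
    have h2 := P2 i x
    have hr := cylRadius_nonneg x
    rw [abs_mul, abs_mul, abs_of_nonneg (hρ0 x), hρr,
      show cylRadius x ^ 2 * |Ω x| * |fderiv ℝ Ω x (e i)| = (cylRadius x * |Ω x|) * (cylRadius x * |fderiv ℝ Ω x (e i)|) by ring]
    calc (cylRadius x * |Ω x|) * (cylRadius x * |fderiv ℝ Ω x (e i)|)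
        ≤ ‖w x‖ * (|fderiv ℝ Ω x (e i)| + 3 * ‖w x‖ + ‖fderiv ℝ w x‖) :=
          mul_le_mul h1 h2 (mul_nonneg hr (abs_nonneg _)) (norm_nonneg _)
      _ = _ := by ring
  -- `ρ (∂ᵢΩ)²`
  have iA : ∀ i, Integrable (fun x => ρ x * fderiv ℝ Ω x (e i) ^ 2) volume := by
    intro i
    have ig : Integrable (fun x => 3 * (fderiv ℝ Ω x (e i) ^ 2 + ‖w x‖ ^ 2 * 9 + ‖fderiv ℝ w x‖ ^ 2)) volume := by
      refine (((m1Ω i).integrable_sq.add (mw0.integrable_sq.mul_const 9)).add mw1.integrable_sq).const_mul 3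
    refine mono (cρ.mul ((cDΩ _).pow 2)) ig fun x => ?_
    rw [abs_of_nonneg (mul_nonneg (hρ0 x) (sq_nonneg _)), hρr,
      show cylRadius x ^ 2 * fderiv ℝ Ω x (e i) ^ 2 = (cylRadius x * |fderiv ℝ Ω x (e i)|) ^ 2 by rw [mul_pow, sq_abs]]
    calc (cylRadius x * |fderiv ℝ Ω x (e i)|) ^ 2 ≤ (|fderiv ℝ Ω x (e i)| + 3 * ‖w x‖ + ‖fderiv ℝ w x‖) ^ 2 :=
          pow_le_pow_left₀ (mul_nonneg (cylRadius_nonneg x) (abs_nonneg _)) (P2 i x) 2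
      _ ≤ 3 * (|fderiv ℝ Ω x (e i)| ^ 2 + (3 * ‖w x‖) ^ 2 + ‖fderiv ℝ w x‖ ^ 2) := sq_add_three_le_aux _ _ _
      _ = _ := by rw [sq_abs]; ring
  -- `Ω ∂ᵢ(ρ ∂ᵢΩ)`
  have hDΩi : ∀ i, Differentiable ℝ fun y => fderiv ℝ Ω y (e i) := fun i =>
    (contDiff_fderiv_apply_vec3_of_contDiff hΩ (e i)).differentiable (by simp)
  have hDg : ∀ (i : Fin 3) x, fderiv ℝ (fun y => ρ y * fderiv ℝ Ω y (e i)) x (e i) =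
      2 * (x 0 * e i 0 + x 1 * e i 1) * fderiv ℝ Ω x (e i) + ρ x * fderiv ℝ (fun y => fderiv ℝ Ω y (e i)) x (e i) := by
    intro i x
    rw [fderiv_fun_mul (hasFDerivAt_horizSq x).differentiableAt (hDΩi i x), _root_.add_apply,
      _root_.FunLike.coe_smul, _root_.FunLike.coe_smul, Pi.smul_apply, Pi.smul_apply, smul_eq_mul, smul_eq_mul,
      fderiv_horizSq_apply]
    ring
  have iB : ∀ i, Integrable (fun x => Ω x * fderiv ℝ (fun y => ρ y * fderiv ℝ Ω y (e i)) x (e i)) volume := by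
    intro i
    have ig : Integrable (fun x => 2 * (‖w x‖ * |fderiv ℝ Ω x (e i)|) +
        (‖w x‖ * ‖fderiv ℝ (fun y => fderiv ℝ w y (e i)) x‖ + 2 * (|Ω x| * ‖fderiv ℝ w x‖) + 2 * Ω x ^ 2 +
          4 * (‖w x‖ * |fderiv ℝ Ω x (e i)|))) volume :=
      ((mw0.integrable_mul (m1Ω i).abs).const_mul 2).add
        ((((mw0.integrable_mul (mw2 i)).add ((m0Ω.abs.integrable_mul mw1).const_mul 2)).add
          (m0Ω.integrable_sq.const_mul 2)).add ((mw0.integrable_mul (m1Ω i).abs).const_mul 4))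
    have hs : ∀ x : EuclideanSpace ℝ (Fin 3), |x 0 * e i 0 + x 1 * e i 1| ≤ cylRadius x := fun x =>
      (abs_horizontal_inner_le x (e i)).trans (by
        calc Real.sqrt (x 0 ^ 2 + x 1 ^ 2) * ‖e i‖ ≤ Real.sqrt (x 0 ^ 2 + x 1 ^ 2) * 1 :=
              mul_le_mul_of_nonneg_left (hne i) (Real.sqrt_nonneg _)
          _ = cylRadius x := mul_one _)
    have hfun : (fun x => Ω x * fderiv ℝ (fun y => ρ y * fderiv ℝ Ω y (e i)) x (e i)) = fun x =>
        Ω x * (2 * (x 0 * e i 0 + x 1 * e i 1) * fderiv ℝ Ω x (e i) + ρ x * fderiv ℝ (fun y => fderiv ℝ Ω y (e i)) x (e i)) := by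
      funext x; rw [hDg]
    rw [hfun]
    have cs : Continuous fun x : EuclideanSpace ℝ (Fin 3) => x 0 * e i 0 + x 1 * e i 1 :=
      ((contDiff_piLp_apply (𝕜 := ℝ) (p := 2) (n := 0) (i := (0 : Fin 3))).continuous.mul continuous_const).add
        ((contDiff_piLp_apply (𝕜 := ℝ) (p := 2) (n := 0) (i := (1 : Fin 3))).continuous.mul continuous_const)
    refine mono (cΩ.mul (((continuous_const.mul cs).mul (cDΩ _)).add (cρ.mul (cDDΩ i)))) ig fun x => ?_
    have h4 := P4 i x
    have h1 := P1 x
    have hsx := hs x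
    have hr := cylRadius_nonneg x
    have hA : |Ω x * (2 * (x 0 * e i 0 + x 1 * e i 1) * fderiv ℝ Ω x (e i))| ≤ 2 * (‖w x‖ * |fderiv ℝ Ω x (e i)|) := by
      rw [abs_mul, abs_mul, abs_mul, abs_two]
      calc |Ω x| * (2 * |x 0 * e i 0 + x 1 * e i 1| * |fderiv ℝ Ω x (e i)|)
          = 2 * ((|x 0 * e i 0 + x 1 * e i 1| * |Ω x|) * |fderiv ℝ Ω x (e i)|) := by ring
        _ ≤ 2 * ((cylRadius x * |Ω x|) * |fderiv ℝ Ω x (e i)|) := by gcongr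
        _ ≤ 2 * (‖w x‖ * |fderiv ℝ Ω x (e i)|) := by gcongr
    have hB' : |Ω x * (ρ x * fderiv ℝ (fun y => fderiv ℝ Ω y (e i)) x (e i))| ≤
        ‖w x‖ * ‖fderiv ℝ (fun y => fderiv ℝ w y (e i)) x‖ + 2 * (|Ω x| * ‖fderiv ℝ w x‖) + 2 * Ω x ^ 2 +
          4 * (‖w x‖ * |fderiv ℝ Ω x (e i)|) := by
      rw [abs_mul, abs_mul, abs_of_nonneg (hρ0 x)]
      calc |Ω x| * (ρ x * |fderiv ℝ (fun y => fderiv ℝ Ω y (e i)) x (e i)|) ≤ _ := h4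
        _ = _ := by ring
    rw [mul_add]
    exact (abs_add_le _ _).trans (add_le_add hA hB')
  -- `Ω ρ ∂ᵢΩ`
  have iC : ∀ i, Integrable (fun x => Ω x * (ρ x * fderiv ℝ Ω x (e i))) volume := fun i =>
    (iP i).congr (ae_of_all _ fun x => by simp only; ring)
  -- source integrands
  have i1 : Integrable (fun x => ρ x * fderiv ℝ Ω x (e 2) * Φ x ^ 2) volume := by
    have ig : Integrable (fun x => B * ((|fderiv ℝ Ω x (e 2)| + 3 * ‖w x‖ + ‖fderiv ℝ w x‖) * |Φ x|)) volume := by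
      have : Integrable (fun x => (|fderiv ℝ Ω x (e 2)| + 3 * ‖w x‖ + ‖fderiv ℝ w x‖) * |Φ x|) volume :=
        (((m1Ω 2).abs.add (mw0.const_mul 3)).add mw1).integrable_mul m0Φ.abs
      exact this.const_mul B
    refine mono ((cρ.mul (cDΩ _)).mul (cΦ.pow 2)) ig fun x => ?_
    have hr := cylRadius_nonneg x
    rw [abs_mul, abs_mul, abs_of_nonneg (hρ0 x), hρr, abs_pow, sq, sq,
      show cylRadius x * cylRadius x * |fderiv ℝ Ω x (e 2)| * (|Φ x| * |Φ x|) =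
        (cylRadius x * |Φ x|) * ((cylRadius x * |fderiv ℝ Ω x (e 2)|) * |Φ x|) by ring]
    have hfin : (cylRadius x * |Φ x|) * ((cylRadius x * |fderiv ℝ Ω x (e 2)|) * |Φ x|) ≤
        B * ((|fderiv ℝ Ω x (e 2)| + 3 * ‖w x‖ + ‖fderiv ℝ w x‖) * |Φ x|) := by
      refine mul_le_mul (P1Φ x) (mul_le_mul_of_nonneg_right (P2 2 x) (abs_nonneg _)) ?_ hB0
      positivity
    exact hfin
  have i2 : Integrable (fun x => ρ x * Ω x * (Φ x * fderiv ℝ Φ x (e 2))) volume := by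
    have ig : Integrable (fun x => B * (‖w x‖ * |fderiv ℝ Φ x (e 2)|)) volume :=
      (mw0.integrable_mul (m1Φ 2).abs).const_mul B
    refine mono ((cρ.mul cΩ).mul (cΦ.mul (cDΦ _))) ig fun x => ?_
    have hr := cylRadius_nonneg x
    rw [abs_mul, abs_mul, abs_mul, abs_of_nonneg (hρ0 x), hρr, sq,
      show cylRadius x * cylRadius x * |Ω x| * (|Φ x| * |fderiv ℝ Φ x (e 2)|) =
        (cylRadius x * |Φ x|) * ((cylRadius x * |Ω x|) * |fderiv ℝ Φ x (e 2)|) by ring]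
    have hfin : (cylRadius x * |Φ x|) * ((cylRadius x * |Ω x|) * |fderiv ℝ Φ x (e 2)|) ≤
        B * (‖w x‖ * |fderiv ℝ Φ x (e 2)|) := by
      refine mul_le_mul (P1Φ x) (mul_le_mul_of_nonneg_right (P1 x) (abs_nonneg _)) ?_ hB0
      positivity
    exact hfin
  have i3 : Integrable (fun x => ρ x * Ω x * Φ x ^ 2) volume := by
    have ig : Integrable (fun x => B * (‖w x‖ * |Φ x|)) volume := (mw0.integrable_mul m0Φ.abs).const_mul B
    refine mono ((cρ.mul cΩ).mul (cΦ.pow 2)) ig fun x => ?_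
    have hr := cylRadius_nonneg x
    rw [abs_mul, abs_mul, abs_of_nonneg (hρ0 x), hρr, abs_pow, sq, sq,
      show cylRadius x * cylRadius x * |Ω x| * (|Φ x| * |Φ x|) =
        (cylRadius x * |Φ x|) * ((cylRadius x * |Ω x|) * |Φ x|) by ring]
    have hfin : (cylRadius x * |Φ x|) * ((cylRadius x * |Ω x|) * |Φ x|) ≤ B * (‖w x‖ * |Φ x|) := by
      refine mul_le_mul (P1Φ x) (mul_le_mul_of_nonneg_right (P1 x) (abs_nonneg _)) ?_ hB0
      positivity
    exact hfin
  have i5 : Integrable (fun x => ρ x * Φ x ^ 4) volume := by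
    have ig : Integrable (fun x => B ^ 2 * Φ x ^ 2) volume := m0Φ.integrable_sq.const_mul _
    refine mono (cρ.mul (cΦ.pow 4)) ig fun x => ?_
    rw [abs_of_nonneg (mul_nonneg (hρ0 x) (by positivity)),
      show ρ x * Φ x ^ 4 = (ρ x * Φ x ^ 2) * Φ x ^ 2 by ring]
    exact mul_le_mul_of_nonneg_right (hρB x) (sq_nonneg _)
  -- the time-derivative integrand
  have iT : Integrable (fun x => ρ x * Ω x * Ω' x) volume := by
    refine mono ((cρ.mul cΩ).mul cΩ') (mw0.integrable_mul mwt0) fun x => ?_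
    have hr := cylRadius_nonneg x
    rw [abs_mul, abs_mul, abs_of_nonneg (hρ0 x), hρr, sq,
      show cylRadius x * cylRadius x * |Ω x| * |Ω' x| = (cylRadius x * |Ω x|) * (cylRadius x * |Ω' x|) by ring]
    exact mul_le_mul (P1 x) (P1t x) (mul_nonneg hr (abs_nonneg _)) (norm_nonneg _)
  -- the transport integrand `ρ Ω ∇Ω·u`
  have hbiB : ∀ (i : Fin 3) x, |u τ x i| ≤ B := fun i x =>
    (Real.norm_eq_abs _ ▸ PiLp.norm_apply_le (u τ x) i).trans (hB τ hτ x)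
  have iTr : Integrable (fun x => ρ x * Ω x * fderiv ℝ Ω x (u τ x)) volume := by
    have iQ : ∀ i : Fin 3, Integrable (fun x => u τ x i * (ρ x * Ω x * fderiv ℝ Ω x (e i))) volume := fun i =>
      (iP i).bdd_mul (c := B) (contDiff_apply_coord_vec3 hu1 i).continuous.aestronglyMeasurable
        (ae_of_all _ fun x => by rw [Real.norm_eq_abs]; exact hbiB i x)
    refine (((iQ 0).add (iQ 1)).add (iQ 2)).congr (ae_of_all _ fun x => ?_)
    simp only [Pi.add_apply]
    rw [fderiv_apply_eq_sum_three Ω x (u τ x)]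
    simp only [he']; ring
  ------------------------------------------------------------------
  -- the equation multiplied by `ρ Ω` and integrated
  ------------------------------------------------------------------
  have hJ : ∀ x, radVelQuot (FluidPDE.curl (u τ)) x = -fderiv ℝ Φ x (e 2) := fun x =>
    haxτ.radVelQuot_curl_eq_neg_fderiv_angVelQuot hu3 x
  have hpde : ∀ x, ρ x * Ω x * Ω' x = -(ρ x * Ω x * fderiv ℝ Ω x (u τ x)) +
      ρ x * Ω x * ((Δ Ω) x + 2 * radDerivQuot Ω x) + 2 * (ρ x * Ω x * (Φ x * fderiv ℝ Φ x (e 2))) := by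
    intro x
    have hq := hcl.angVortQuot_eq hU hIcl hax hτ x
    rw [hJ x] at hq
    have : Ω' x = -(fderiv ℝ Ω x (u τ x)) + 1 * ((Δ Ω) x + 2 * radDerivQuot Ω x) +
        2 * (Φ x * fderiv ℝ Φ x (e 2)) := by linarith
    rw [this]; ring
  have iV : Integrable (fun x => ρ x * Ω x * ((Δ Ω) x + 2 * radDerivQuot Ω x)) volume := by
    have : (fun x => ρ x * Ω x * ((Δ Ω) x + 2 * radDerivQuot Ω x)) = fun x =>
        ρ x * Ω x * Ω' x + ρ x * Ω x * fderiv ℝ Ω x (u τ x) - 2 * (ρ x * Ω x * (Φ x * fderiv ℝ Φ x (e 2))) := by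
      funext x; rw [hpde]; ring
    rw [this]
    exact (iT.add iTr).sub (i2.const_mul 2)
  have hsplit : ∫ x, ρ x * Ω x * Ω' x = -(∫ x, ρ x * Ω x * fderiv ℝ Ω x (u τ x)) +
      (∫ x, ρ x * Ω x * ((Δ Ω) x + 2 * radDerivQuot Ω x)) + 2 * ∫ x, ρ x * Ω x * (Φ x * fderiv ℝ Φ x (e 2)) := by
    have iN : Integrable (fun x => -(ρ x * Ω x * fderiv ℝ Ω x (u τ x))) volume := iTr.neg
    have iNV : Integrable (fun x => -(ρ x * Ω x * fderiv ℝ Ω x (u τ x)) +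
        ρ x * Ω x * ((Δ Ω) x + 2 * radDerivQuot Ω x)) volume := iN.add iV
    have i22 : Integrable (fun x => 2 * (ρ x * Ω x * (Φ x * fderiv ℝ Φ x (e 2)))) volume := i2.const_mul 2
    rw [integral_congr_ae (ae_of_all _ hpde), integral_add iNV i22, integral_add iN iV, integral_neg,
      integral_const_mul]
  -- the three terms
  have hΩax : IsAxisymmetricScalar Ω := haxτ.isAxisymmetricScalar_angVortQuot hu3
  have hT2 := integral_horizSq_mul_mul_fderiv_apply_eq (contDiff_infty.1 hΩ 1) hu1 hdiv (hB τ hτ) hDb iF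
    (iX 0 (Or.inl rfl)) (iX 1 (Or.inr rfl)) iP
  have hT3 := integral_horizSq_mul_mul_laplacian_add_eq (contDiff_infty.1 hΩ 3) hΩax iA iB iC
  have hT4 := two_mul_integral_horizSq_mul_mul_mul_fderiv_le (contDiff_infty.1 hΩ 1) (contDiff_infty.1 hΦ 1)
    i1 i2 i3 (iA 2) i5
  simp only [he', hρ'] at hT2 hT3 hT4
  -- `∫ (x·u_h) Ω² = ∫ ρ W Ω² ≤ Wsup ∫ ρ Ω²`
  have hxu : ∀ x, x 0 * u τ x 0 + x 1 * u τ x 1 = ρ x * W x := fun x => by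
    rw [hρr]; exact (haxτ.cylRadius_sq_mul_radVelQuot hu2 x).symm
  have hWbd : ∫ x, (x 0 * u τ x 0 + x 1 * u τ x 1) * Ω x ^ 2 ≤ Wsup * ∫ x, ρ x * Ω x ^ 2 := by
    rw [← integral_const_mul]
    have iL : Integrable (fun x => (x 0 * u τ x 0 + x 1 * u τ x 1) * Ω x ^ 2) volume := by
      have : (fun x => (x 0 * u τ x 0 + x 1 * u τ x 1) * Ω x ^ 2) = fun x => W x * (ρ x * Ω x ^ 2) := by
        funext x; rw [hxu]; ring
      rw [this]
      have hWB : ∀ x, ‖W x‖ ≤ Wsup := fun x => by rw [Real.norm_eq_abs]; exact hWsup x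
      exact iF.bdd_mul cW.aestronglyMeasurable (ae_of_all _ hWB)
    refine integral_mono iL (iF.const_mul _) fun x => ?_
    beta_reduce
    rw [hxu]
    have h0 : 0 ≤ ρ x * Ω x ^ 2 := mul_nonneg (hρ0 x) (sq_nonneg _)
    have := hWsup x
    have : W x ≤ Wsup := (le_abs_self _).trans this
    nlinarith
  -- `½ ∫ ρ (∂_zΩ)² ≤ ∫ ρ |∇Ω|²`
  have hdiss : ∫ x, ρ x * fderiv ℝ Ω x (e 2) ^ 2 ≤
      ∫ x, ρ x * (fderiv ℝ Ω x (e 0) ^ 2 + fderiv ℝ Ω x (e 1) ^ 2 + fderiv ℝ Ω x (e 2) ^ 2) := by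
    have iS : Integrable (fun x => ρ x * (fderiv ℝ Ω x (e 0) ^ 2 + fderiv ℝ Ω x (e 1) ^ 2 + fderiv ℝ Ω x (e 2) ^ 2)) volume :=
      (((iA 0).add (iA 1)).add (iA 2)).congr (ae_of_all _ fun x => by simp only [Pi.add_apply]; ring)
    refine integral_mono (iA 2) iS fun x => ?_
    beta_reduce
    have := hρ0 x
    nlinarith [mul_nonneg this (sq_nonneg (fderiv ℝ Ω x (e 0))), mul_nonneg this (sq_nonneg (fderiv ℝ Ω x (e 1)))]
  have hd0 : 0 ≤ ∫ x, ρ x * fderiv ℝ Ω x (e 2) ^ 2 := integral_nonneg fun x => mul_nonneg (hρ0 x) (sq_nonneg _)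
  rw [hsplit, hT2]
  nlinarith [hT3, hT4, hWbd, hdiss, hd0]

end Slice

end Literature.Analysis.FluidPDE

end
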